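import Literature.Probability.FitznerVanDerHofstad2017.SrwLawRates
import Literature.Probability.FitznerVanDerHofstad2017.SrwIntegralMonotone

/-!
# Literature.Probability.FitznerVanDerHofstad2017.SrwLawDimMonotoneAllX — the SRW transition probabilities and the
SRW integrals `I_{n,l}(x)` are non-increasing in the dimension at EVERY endpoint

CITATION HEADER (PLACEMENT v2). Build `lace`, node N52 (i) / obligations O1a–O1b of `HOME/b2b-lace-num5-g5/RESULTS.md`
§4 (seat dmps-g13); paper proof `HOME/b2b-lace-dmps-g13/DMONO-ALLX.md` §§4–5.  Third of three files
(`BinomialCoincidenceMonotone`, `SrwLawRates`, this file).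

**Theorem (`srwLaw_dim_succ_le_allx`).** For `d ≥ 1`, every `N` and every `y ∈ ℤ^{d+1}` with `y_{d+1} = 0`,
`p_N^{(d+1)}(y) ≤ p_N^{(d)}(y_1, …, y_d)`; equivalently (`srwLaw_dim_succ_le_snoc`) `p_N^{(d+1)}((x,0)) ≤ p_N^{(d)}(x)` for
every `x ∈ ℤ^d`.  **Corollary (`srwI_dim_succ_le_allx`).** For `d ≥ 2n+1` and all `l, x`,
`I^{(d+1)}_{n,l}((x,0)) ≤ I^{(d)}_{n,l}(x)`.  Iterated (`srwLaw_dim_anti_allx`, `srwI_dim_anti_allx`, zero-padding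
`padZero : ℤ^d → ℤ^{d'}`): `p_N^{(d')}((x,0,…,0)) ≤ p_N^{(d)}(x)` and `I^{(d')}_{n,l}((x,0,…,0)) ≤ I^{(d)}_{n,l}(x)` for all
`d ≤ d'` (with `d ≥ 1`, resp. `d ≥ 2n+1`).

Context: [FvdH21 = FitznerVanDerHofstad2021LTLA, §9, Lemma 9.2] proves the `d`-monotonicity of `I_{n,0}(x; d)` only for
`‖x‖_∞ ≤ 2` (Bessel representation of [HS92b]); the tree had `x = 0` and `x = e_μ` (`SrwIntegralDimMonotoneAll`).  No
restriction on `x` is needed.  Proof (DMONO-ALLX §4): write `p^{(d+1)}` and `p^{(d)}∘init` as the laws of the rate walks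
with rates `c_d = (1/(d+1), …, 1/(d+1))` and `c_0 = (1/d, …, 1/d, 0)` (`RateWalk.rwLaw`, `rwLaw_uniform`,
`rwLaw_chainRates_zero`), and join them by the chain `c_0, c_1, …, c_d`, `c_j = (1/(d+1) on coordinates < j, 1/d on
j ≤ · < d, j/(d(d+1)) on the last)`: consecutive members differ by a rate transfer inside the pair `{j, d+1}` with the
last coordinate's share rising from `j/(d+1+j)` to `(j+1)/(d+1+j) ≤ 1/2`, so each step does not increase `p_N(y)` at
`y_{d+1} = 0` (`RateWalk.rwLaw_pairRates_antitoneOn`, whose planar core is `binomialCoincidence_antitoneOn`).  The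
corollary follows termwise from `I_{0,j} = p_j` and `I_{n+1,m} = Σ_{j ≥ m} I_{n,j}` (`tendsto_sum_range_srwI`).
Everything is proved; nothing is a cited fact.

[folklore]
-/

noncomputable section

open Finset Set Filter
open scoped Topology

namespace Literature.Probability.FitznerVanDerHofstad2017

namespace RateWalk

open BinCoincidence
open Literature.Barriers.CriticalPhenomena

variable {d : ℕ}

/-! ### Coordinates: `last` versus `castSucc` -/

/-- Adding `c e_k` (`k < d`) does not change the last coordinate. [folklore] -/
theorem apply_last_add_single_castSucc (z : Fin (d + 1) → ℤ) (k : Fin d) (c : ℤ) :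
    (z + Pi.single (Fin.castSucc k) c : Fin (d + 1) → ℤ) (Fin.last d) = z (Fin.last d) := by
  simp

/-- Subtracting `c e_k` (`k < d`) does not change the last coordinate. [folklore] -/
theorem apply_last_sub_single_castSucc (z : Fin (d + 1) → ℤ) (k : Fin d) (c : ℤ) :
    (z - Pi.single (Fin.castSucc k) c : Fin (d + 1) → ℤ) (Fin.last d) = z (Fin.last d) := by
  simp

/-- `init (z + c e_k) = init z + c e_k`. [folklore] -/
theorem init_add_single_castSucc (z : Fin (d + 1) → ℤ) (k : Fin d) (c : ℤ) :
    Fin.init (z + Pi.single (Fin.castSucc k) c) = Fin.init z + Pi.single k c := by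
  funext i
  simp [Fin.init, Pi.single_apply]

/-- `init (z - c e_k) = init z - c e_k`. [folklore] -/
theorem init_sub_single_castSucc (z : Fin (d + 1) → ℤ) (k : Fin d) (c : ℤ) :
    Fin.init (z - Pi.single (Fin.castSucc k) c) = Fin.init z - Pi.single k c := by
  funext i
  simp [Fin.init, Pi.single_apply]

/-- `z = 0 ↔ z_{d+1} = 0 ∧ init z = 0`. [folklore] -/
theorem eq_zero_iff_last_init (z : Fin (d + 1) → ℤ) :
    z = 0 ↔ z (Fin.last d) = 0 ∧ Fin.init z = 0 := by
  constructor
  · rintro rfl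
    exact ⟨rfl, rfl⟩
  · rintro ⟨h1, h2⟩
    funext i
    rcases Fin.eq_castSucc_or_eq_last i with ⟨k, rfl⟩ | rfl
    · exact congr_fun h2 k
    · exact h1

/-! ### The chain of rate vectors -/

/-- The chain rates `c_j` on `ℤ^{d+1}`: `1/(d+1)` on coordinates `< j`, `1/d` on coordinates `j ≤ · < d`,
and `j/(d(d+1))` on the last coordinate. [folklore] -/
def chainRates (d j : ℕ) : Fin (d + 1) → ℝ :=
  fun i => if i = Fin.last d then (j : ℝ) / ((d : ℝ) * ((d : ℝ) + 1))
    else if (i : ℕ) < j then 1 / ((d : ℝ) + 1) else 1 / (d : ℝ)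

/-- The chain rates are non-negative. [folklore] -/
theorem chainRates_nonneg (d j : ℕ) (i : Fin (d + 1)) : 0 ≤ chainRates d j i := by
  unfold chainRates
  split_ifs <;> positivity

/-- `c_d` is the uniform rate vector `(1/(d+1), …, 1/(d+1))` (`d ≥ 1`). [folklore] -/
theorem chainRates_self (hd : 1 ≤ d) : chainRates d d = fun _ : Fin (d + 1) => (1 / (d + 1 : ℕ) : ℝ) := by
  have hd' : (d : ℝ) ≠ 0 := by exact_mod_cast (show d ≠ 0 by omega)
  funext i
  unfold chainRates
  split_ifs with h1 h2
  · push_cast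
    field_simp
  · push_cast
    ring
  · exact absurd (Fin.val_lt_last h1) h2

/-- The rate walk with rates `c_0 = (1/d, …, 1/d, 0)` is simple random walk in the first `d` coordinates:
`rwLaw c_0 n z = p_n^{(d)}(init z)` if `z_{d+1} = 0`, and `0` otherwise. [folklore] -/
theorem rwLaw_chainRates_zero (n : ℕ) (z : Fin (d + 1) → ℤ) :
    rwLaw (chainRates d 0) n z =
      if z (Fin.last d) = 0 then LongRangePhi4.srwLaw d n (Fin.init z) else 0 := by
  induction n generalizing z with
  | zero =>
    rw [rwLaw_zero_apply, LongRangePhi4.srwLaw_zero_apply]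
    by_cases h1 : z (Fin.last d) = 0
    · by_cases h2 : Fin.init z = 0
      · rw [if_pos ((eq_zero_iff_last_init z).2 ⟨h1, h2⟩), if_pos h1, if_pos h2]
      · rw [if_pos h1, if_neg h2, if_neg]
        exact fun h => h2 ((eq_zero_iff_last_init z).1 h).2
    · rw [if_neg h1, if_neg]
      exact fun h => h1 ((eq_zero_iff_last_init z).1 h).1
  | succ n ih =>
    rw [rwLaw_succ_apply, Fin.sum_univ_castSucc]
    have hlast : chainRates d 0 (Fin.last d) = 0 := by simp [chainRates]
    have hcast : ∀ k : Fin d, chainRates d 0 (Fin.castSucc k) = 1 / (d : ℝ) := by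
      intro k
      simp [chainRates, (Fin.castSucc_lt_last k).ne]
    rw [hlast, zero_mul, add_zero]
    simp_rw [hcast, ih, apply_last_add_single_castSucc, apply_last_sub_single_castSucc,
      init_add_single_castSucc, init_sub_single_castSucc]
    by_cases h1 : z (Fin.last d) = 0
    · simp only [if_pos h1]
      rw [LongRangePhi4.srwLaw_succ_apply, Finset.sum_div]
      refine Finset.sum_congr rfl fun k _ => ?_
      ring
    · simp only [if_neg h1]
      simp

/-- One link of the chain: for `j < d`, `c_j` and `c_{j+1}` are the pair rates with `μ = j`, `ν = d+1` (the last
coordinate), total pair rate `ρ = (d+1+j)/(d(d+1))` and shares `γ = j/(d+1+j)` resp. `(j+1)/(d+1+j)`. [folklore] -/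
theorem chainRates_eq_pairRates (hd : 1 ≤ d) {j : ℕ} (hj : j < d) :
    chainRates d j = pairRates (chainRates d j) (Fin.castSucc ⟨j, hj⟩) (Fin.last d)
        (((d : ℝ) + 1 + j) / ((d : ℝ) * ((d : ℝ) + 1))) ((j : ℝ) / ((d : ℝ) + 1 + j)) ∧
    chainRates d (j + 1) = pairRates (chainRates d j) (Fin.castSucc ⟨j, hj⟩) (Fin.last d)
        (((d : ℝ) + 1 + j) / ((d : ℝ) * ((d : ℝ) + 1))) (((j : ℝ) + 1) / ((d : ℝ) + 1 + j)) := by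
  have hd' : (d : ℝ) ≠ 0 := by exact_mod_cast (show d ≠ 0 by omega)
  have hdj : (d : ℝ) + 1 + j ≠ 0 := by positivity
  have hne : Fin.castSucc (⟨j, hj⟩ : Fin d) ≠ Fin.last d := (Fin.castSucc_lt_last _).ne
  constructor
  · funext i
    unfold chainRates pairRates
    by_cases hi : i = Fin.last d
    · rw [if_pos hi, if_pos hi]
      field_simp
    · rw [if_neg hi, if_neg hi]
      by_cases hiμ : i = Fin.castSucc ⟨j, hj⟩
      · rw [if_pos hiμ]
        have hij : (i : ℕ) = j := by rw [hiμ]; rfl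
        rw [if_neg (by omega)]
        field_simp
        ring
      · rw [if_neg hiμ]
        beta_reduce
        rw [if_neg hi]
  · funext i
    unfold chainRates pairRates
    by_cases hi : i = Fin.last d
    · rw [if_pos hi, if_pos hi]
      push_cast
      field_simp
    · rw [if_neg hi, if_neg hi]
      by_cases hiμ : i = Fin.castSucc ⟨j, hj⟩
      · rw [if_pos hiμ]
        have hij : (i : ℕ) = j := by rw [hiμ]; rfl
        rw [if_pos (by omega)]
        field_simp
        ring
      · rw [if_neg hiμ]
        beta_reduce
        rw [if_neg hi]
        have hij : (i : ℕ) ≠ j := by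
          intro h
          apply hiμ
          ext
          exact h
        by_cases hlt : (i : ℕ) < j
        · rw [if_pos hlt, if_pos (by omega)]
        · rw [if_neg hlt, if_neg (by omega)]

/-- One link of the chain does not increase `p_N(z)` at `z_{d+1} = 0`. [folklore] -/
theorem rwLaw_chainRates_succ_le (hd : 1 ≤ d) {j : ℕ} (hj : j < d) (N : ℕ) {z : Fin (d + 1) → ℤ}
    (hz : z (Fin.last d) = 0) :
    rwLaw (chainRates d (j + 1)) N z ≤ rwLaw (chainRates d j) N z := by
  obtain ⟨h0, h1⟩ := chainRates_eq_pairRates hd hj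
  have hne : Fin.castSucc (⟨j, hj⟩ : Fin d) ≠ Fin.last d := (Fin.castSucc_lt_last _).ne
  have hρ : 0 ≤ ((d : ℝ) + 1 + j) / ((d : ℝ) * ((d : ℝ) + 1)) := by positivity
  have hanti := rwLaw_pairRates_antitoneOn hne (chainRates_nonneg d j) hρ N hz
  have hdj : (0 : ℝ) < (d : ℝ) + 1 + j := by positivity
  have hγ0 : (j : ℝ) / ((d : ℝ) + 1 + j) ∈ Icc (0 : ℝ) (1 / 2) := by
    constructor
    · positivity
    · rw [div_le_iff₀ hdj]
      have : (j : ℝ) ≤ d := by exact_mod_cast hj.le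
      linarith
  have hγ1 : ((j : ℝ) + 1) / ((d : ℝ) + 1 + j) ∈ Icc (0 : ℝ) (1 / 2) := by
    constructor
    · positivity
    · rw [div_le_iff₀ hdj]
      have : (j : ℝ) + 1 ≤ d := by exact_mod_cast hj
      linarith
  have hle : (j : ℝ) / ((d : ℝ) + 1 + j) ≤ ((j : ℝ) + 1) / ((d : ℝ) + 1 + j) :=
    div_le_div_of_nonneg_right (by linarith) hdj.le
  have h := hanti hγ0 hγ1 hle
  simp only at h
  rw [← h0, ← h1] at h
  exact h

/-- The whole chain: `p^{c_j}_N(z) ≤ p^{c_0}_N(z)` for `j ≤ d`, at `z_{d+1} = 0`. [folklore] -/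
theorem rwLaw_chainRates_le_zero (hd : 1 ≤ d) {j : ℕ} (hj : j ≤ d) (N : ℕ) {z : Fin (d + 1) → ℤ}
    (hz : z (Fin.last d) = 0) :
    rwLaw (chainRates d j) N z ≤ rwLaw (chainRates d 0) N z := by
  induction j with
  | zero => exact le_rfl
  | succ j ih => exact (rwLaw_chainRates_succ_le hd (by omega) N hz).trans (ih (by omega))

/-! ### The theorems -/

/-- **`p_N` is non-increasing in the dimension at every endpoint**: for `d ≥ 1`, all `N` and all `y ∈ ℤ^{d+1}` with
`y_{d+1} = 0`, `p_N^{(d+1)}(y) ≤ p_N^{(d)}(y_1,…,y_d)`.  ([FvdH21, Lemma 9.2] has the case `‖y‖_∞ ≤ 2` for the SRW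
integrals; DMONO-ALLX §4.) [folklore] -/
theorem srwLaw_dim_succ_le_allx (hd : 1 ≤ d) (N : ℕ) (y : Fin (d + 1) → ℤ) (hy : y (Fin.last d) = 0) :
    LongRangePhi4.srwLaw (d + 1) N y ≤ LongRangePhi4.srwLaw d N (Fin.init y) := by
  have h1 : LongRangePhi4.srwLaw (d + 1) N y = rwLaw (chainRates d d) N y := by
    rw [chainRates_self hd, rwLaw_uniform]
  have h2 : LongRangePhi4.srwLaw d N (Fin.init y) = rwLaw (chainRates d 0) N y := by
    rw [rwLaw_chainRates_zero, if_pos hy]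
  rw [h1, h2]
  exact rwLaw_chainRates_le_zero hd le_rfl N hy

/-- The same with the endpoint written as `(x, 0)`: `p_N^{(d+1)}((x,0)) ≤ p_N^{(d)}(x)` for every `x ∈ ℤ^d`
(`d ≥ 1`). [folklore] -/
theorem srwLaw_dim_succ_le_snoc (hd : 1 ≤ d) (N : ℕ) (x : Fin d → ℤ) :
    LongRangePhi4.srwLaw (d + 1) N (Fin.snoc x 0) ≤ LongRangePhi4.srwLaw d N x := by
  have h := srwLaw_dim_succ_le_allx hd N (Fin.snoc x 0) (by simp)
  simpa [Fin.init_snoc] using h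

end RateWalk

open RateWalk Literature.Barriers.CriticalPhenomena

variable {d : ℕ}

/-- **The SRW integrals are non-increasing in the dimension at every endpoint**: for `d ≥ 2n+1` and all `l`,
all `y ∈ ℤ^{d+1}` with `y_{d+1} = 0`, `I^{(d+1)}_{n,l}(y) ≤ I^{(d)}_{n,l}(y_1,…,y_d)` — termwise from
`srwLaw_dim_succ_le_allx`, `I_{0,j} = p_j` and `I_{n+1,m} = Σ_{j ≥ m} I_{n,j}`.  ([FvdH21, Lemma 9.2]: `l = 0`,
`‖y‖_∞ ≤ 2`.) [folklore] -/
theorem srwI_dim_succ_le_allx {n : ℕ} (hd : 2 * n + 1 ≤ d) (l : ℕ) (y : Fin (d + 1) → ℤ)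
    (hy : y (Fin.last d) = 0) :
    srwI (d + 1) n l y ≤ srwI d n l (Fin.init y) := by
  induction n generalizing l with
  | zero =>
    rw [srwI_zero_eq_srwLaw, srwI_zero_eq_srwLaw]
    exact srwLaw_dim_succ_le_allx (by omega) l y hy
  | succ n ih =>
    have hA := tendsto_sum_range_srwI (d := d + 1) (n := n) (by omega) l y
    have hB := tendsto_sum_range_srwI (d := d) (n := n) (by omega) l (Fin.init y)
    exact le_of_tendsto_of_tendsto' hA hB fun N =>
      Finset.sum_le_sum fun j _ => ih (by omega) (l + j)

/-- The same with the endpoint written as `(x, 0)`: `I^{(d+1)}_{n,l}((x,0)) ≤ I^{(d)}_{n,l}(x)` (`d ≥ 2n+1`).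
[folklore] -/
theorem srwI_dim_succ_le_snoc {n : ℕ} (hd : 2 * n + 1 ≤ d) (l : ℕ) (x : Fin d → ℤ) :
    srwI (d + 1) n l (Fin.snoc x 0) ≤ srwI d n l x := by
  have h := srwI_dim_succ_le_allx hd l (Fin.snoc x 0) (by simp)
  simpa [Fin.init_snoc] using h

/-! ### All larger dimensions: zero-padding -/

/-- Zero-padding `ℤ^d → ℤ^{d'}` (`d ≤ d'`): `(x_1,…,x_d) ↦ (x_1,…,x_d,0,…,0)`. [folklore] -/
def padZero {d d' : ℕ} (_h : d ≤ d') (x : Fin d → ℤ) : Fin d' → ℤ :=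
  fun i => if hi : (i : ℕ) < d then x ⟨i, hi⟩ else 0

/-- Padding to the same dimension is the identity. [folklore] -/
theorem padZero_rfl {d : ℕ} (x : Fin d → ℤ) : padZero le_rfl x = x := by
  funext i
  simp [padZero, i.isLt]

/-- The last coordinate of a padding to `d'+1 > d` coordinates vanishes. [folklore] -/
theorem padZero_last {d d' : ℕ} (h : d ≤ d') (x : Fin d → ℤ) :
    padZero (h.trans (Nat.le_succ d')) x (Fin.last d') = 0 := by
  simp only [padZero, Fin.val_last]
  rw [dif_neg (by omega)]

/-- `init` of the padding to `d'+1` coordinates is the padding to `d'` coordinates. [folklore] -/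
theorem init_padZero {d d' : ℕ} (h : d ≤ d') (x : Fin d → ℤ) :
    Fin.init (padZero (h.trans (Nat.le_succ d')) x) = padZero h x := by
  funext i
  simp [Fin.init, padZero]

/-- Coordinates of the padding with index below `d` are those of `x`. [folklore] -/
theorem padZero_apply_of_lt {d d' : ℕ} (h : d ≤ d') (x : Fin d → ℤ) (i : Fin d') (hi : (i : ℕ) < d) :
    padZero h x i = x ⟨i, hi⟩ := by
  simp [padZero, hi]

/-- Coordinates of the padding with index at least `d` vanish. [folklore] -/
theorem padZero_apply_of_le {d d' : ℕ} (h : d ≤ d') (x : Fin d → ℤ) (i : Fin d') (hi : d ≤ (i : ℕ)) :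
    padZero h x i = 0 := by
  simp [padZero, Nat.not_lt.mpr hi]

/-- Padding the origin gives the origin. [folklore] -/
@[simp] theorem padZero_zero {d d' : ℕ} (h : d ≤ d') : padZero h (0 : Fin d → ℤ) = 0 := by
  funext i
  simp [padZero]

/-- Padding is additive. [folklore] -/
theorem padZero_add {d d' : ℕ} (h : d ≤ d') (x y : Fin d → ℤ) :
    padZero h (x + y) = padZero h x + padZero h y := by
  funext i
  by_cases hi : (i : ℕ) < d <;> simp [padZero, hi]

/-- Padding a multiple of a coordinate vector, `c • e_i ↦ c • e_i` (same index, read in `ℤ^{d'}`); with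
`padZero_add` this identifies the padded consumer endpoints `e_1`, `2e_1`, `e_1 + e_2`, … by name. [folklore] -/
theorem padZero_single {d d' : ℕ} (h : d ≤ d') (i : Fin d) (c : ℤ) :
    padZero h (Pi.single i c) = Pi.single (Fin.castLE h i) c := by
  funext j
  have hi' := i.isLt
  simp only [padZero, Pi.single_apply, Fin.ext_iff, Fin.val_castLE]
  split_ifs <;> first | rfl | omega

/-- `p_N^{(d')}((x,0,…,0)) ≤ p_N^{(d)}(x)` for all `1 ≤ d ≤ d'`, `N`, `x ∈ ℤ^d`. [folklore] -/
theorem srwLaw_dim_anti_allx {d d' : ℕ} (hd : 1 ≤ d) (hdd' : d ≤ d') (N : ℕ) (x : Fin d → ℤ) :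
    LongRangePhi4.srwLaw d' N (padZero hdd' x) ≤ LongRangePhi4.srwLaw d N x := by
  induction d', hdd' using Nat.le_induction with
  | base => rw [padZero_rfl]
  | succ d' hle ih =>
    refine le_trans ?_ ih
    have h := RateWalk.srwLaw_dim_succ_le_allx (d := d') (by omega) N
      (padZero (hle.trans (Nat.le_succ d')) x) (padZero_last hle x)
    rwa [init_padZero] at h

/-- `I^{(d')}_{n,l}((x,0,…,0)) ≤ I^{(d)}_{n,l}(x)` for all `2n+1 ≤ d ≤ d'`, `l`, `x ∈ ℤ^d`:
[FvdH21, Def. 9.1 / Lemma 9.2] without the restriction `‖x‖_∞ ≤ 2`. [folklore] -/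
theorem srwI_dim_anti_allx {n d d' : ℕ} (hd : 2 * n + 1 ≤ d) (hdd' : d ≤ d') (l : ℕ) (x : Fin d → ℤ) :
    srwI d' n l (padZero hdd' x) ≤ srwI d n l x := by
  induction d', hdd' using Nat.le_induction with
  | base => rw [padZero_rfl]
  | succ d' hle ih =>
    refine le_trans ?_ ih
    have h := srwI_dim_succ_le_allx (d := d') (n := n) (by omega) l
      (padZero (hle.trans (Nat.le_succ d')) x) (padZero_last hle x)
    rwa [init_padZero] at h

end Literature.Probability.FitznerVanDerHofstad2017
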